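import Summits.QuantumFields.YangMills.Theorems.BalabanUVNodesK0AxJoinTD9Images
import Summits.QuantumFields.YangMills.Theorems.BalabanUVNodesK0AxDressLinkOrbit

/-!
# NODE O · K0ᴬ — (R-a) IMAGES EDITIONS (№549: (Tok-cmpU-cap) BYPASSED): ★★★`twoVolExp_dressed_images`, ★★★`twoVolExp_orbit_images`

LANDING NOTE (porter ▶ PTC-1 g4, 2026-08-31; AUTHORSHIP = ◇ lens-1 g10 «cauchy-analytic», HOME sketch `nodeO-cover/LENS-1g10-Rb-6-JoinTDressedImages.lean` sha16 476ff562eb1f5e35 · 119 l. · 2 thm ·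
0 def · 0 sorry): landed VERBATIM (only this paragraph added) under the basename ◇ lens-1 proposed (`…K0AxJoinTDressedImages`), as INTENT-47 (PART B-6) after ★★★ PTB-1's ✓p819355
`…K0AxJoinTD9Images` (★★★`twoVolExp_LocUniv_images` — the ONE name token B-6 assumed, aligned as landed) and ✓p819908 `…K0AxDressLinkOrbit` (B-4), on ★★★ director-ym №549 ((Tok-cmpU-cap) bypassed
by the method of images) ∕ №550 (d3)(d4) and ◆ CRIT-1 g37's cut: (d3) CUT PASS∕GO — (Q-ord) PASS (constants before φ′∕(C-orb)∕TokP9reg♭∕D1), statement diff vs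
✓`twoVolExp_dressed_of_cmp`∕✓`twoVolExp_orbit_of_cmp` = exactly the deleted `TokCmpUCap` hypothesis, (d4) B-6 consumes PTB-1's edition of record by name, (d5) binder census on these bytes:
displayed list = D1 · (C-orb) · TokP9reg♭ · guards — YES, axioms standard on ◆'s own run (nodeO STATUS 2026-08-31T10:24:18Z); helper `--supports stmt-QuantumFields-27238 --as helper` (NO
`--workitem`).  AFTER THIS FILE the (R-a) RUNS road in the
tree displays exactly: D1 ⟨27930⟩ · (C-orb) · TokP9reg♭ · guards.  HONEST (porter): linear algebra over the tree's [B6] model ∕ hypothesis deletions; CONDITIONAL theorems; every displayed letter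
((C-orb)∕(C-wcg)∕(C-crit)∕(C-cons), TokP9reg♭, D1 = ⟨27930⟩'s ⁸ consequent) OPEN, asserted nowhere; [E] inhabited unconditionally NOWHERE; nothing of Bałaban asserted, ported, discharged or
refuted; K0ᴬ stmt-QuantumFields-27238 OPEN — NOTHING of it proved; NODE O 0∕1; COUNT 8∕28 · K 1∕4 UNMOVED; finite 𝕋⁴ at fixed ε — NOT continuum ∕ OS ∕ Clay; the Yang–Mills mass gap is NOT proved
by any of this.

◇ `ymgap-nodeO-lens-1` g10 (planner; typed for the porter ▶ PTC-1; lands AFTER ★ PTB-1's `…K0AxJoinTD9Images` (= ✓`K0AxJoinT.twoVolExp_LocUniv_of_cmp` with the hypothesis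
`TokCmpUCap F Mc a₀ →` DELETED, D9 := ✓`PortU8.portPieceLocalityU8_LocUniv_images`) and after `…K0AxJoinTDressed` (B-3) ∕ `…K0AxDressLinkOrbit` (B-4); target
`Summits/QuantumFields/YangMills/Theorems/BalabanUVNodesK0AxJoinTDressedImages.lean` `--supports stmt-QuantumFields-27238 --as helper`).  ONE TOKEN TO ALIGN AT LANDING: the name of
PTB-1's cap-free §4 theorem is ASSUMED to be `K0AxJoinT.twoVolExp_LocUniv_images` (used ONCE, in §1's `obtain` line, and nowhere else); if PTB-1 names it otherwise, replace that one token.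

WHAT.  The two (R-a) assembled theorems of record — ✓∕▶`K0AxJoinT.twoVolExp_dressed_of_cmp` (B-3: [E] ⟸ D1-at-`recordEmbJ`-on-runs + `DressLink φ′` + HypAn + (Tok-cmpU-cap)) and
✓∕▶`K0AxJoinT.twoVolExp_orbit_of_cmp` (B-4: [E] ⟸ D1 + (C-orb) + TokP9reg♭ + (Tok-cmpU-cap)) — with the displayed hypothesis `TokCmpUCap F Mc a₀ →` DELETED and NOTHING ELSE changed
(statements otherwise byte-identical, (Q-ord) unchanged: `∃ C₉ δ₀` right after `Mc ≤ Mg`, before `φ′`∕(C-orb)∕HypAn∕D1).  Proofs = the B-3∕B-4 proofs with `hcmp` deleted and the images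
§4 in place of the cap §4.  After this file the (R-a) road to [E] displays EXACTLY: D1 ⟨27930⟩ (⁸'s mould at `recordEmbJ` on `]0, γ₀]`-runs), (C-orb) `RootedResponseOrbitAt` at the
record volumes (⟺ (C-wcg), B-5), TokP9reg♭ (C² entries of the rooted background field at 0 = P0∕HypAn) and the guards `McGuard F Mc`, `Mc ≤ Mg`.

HONEST.  CONDITIONAL theorems; every displayed letter OPEN; nothing of Bałaban asserted, ported or discharged; [E] ∕ (E-lu-box) inhabited unconditionally NOWHERE; K0ᴬ 27238 ∕
K0⁷ 20541 OPEN; NODE O 0∕1; COUNT 8∕28 · K 1∕4 unmoved; finite 𝕋⁴_{L^K} at fixed ε — NOT continuum ∕ OS ∕ Clay; the Yang–Mills mass gap is NOT proved.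
-/

noncomputable section

open Filter Topology
open scoped BigOperators Matrix.Norms.L2Operator

namespace Summit.QuantumFields.YangMills.Theorems.K0AxJoinT

open Literature.MathematicalPhysics.QuantumFieldTheory.Balaban1983to89
open Literature.MathematicalPhysics.QuantumFieldTheory.Balaban1983to89.Node00 (betaOfRecord₁₃Ax Stage13Params SU)
open Literature.MathematicalPhysics.QuantumFieldTheory.Balaban1983to89.T4Continuum (T4Family)
open Literature.MathematicalPhysics.QuantumFieldTheory.Balaban1983to89.B12FormatPlus
open Summit.QuantumFields.YangMills.Theorems.K0RecordFormatNames
open Summit.QuantumFields.YangMills.Theorems.K0AxTwoVolumeRate (RecordPvolTwoVolExpOnRunsAx)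
open Literature.MathematicalPhysics.QuantumFieldTheory.Balaban1983to89.FlowStep
open Literature.MathematicalPhysics.QuantumFieldTheory.Balaban1983to89.FlowStepRuns

/-! ## §1  ★★★ `twoVolExp_dressed_images` — B-3 without (Tok-cmpU-cap) -/

/-- ★★★ **`twoVolExp_dressed_images`** = ▶`twoVolExp_dressed_of_cmp` (B-3) with the hypothesis `TokCmpUCap F Mc a₀ →` DELETED (№549, ✓`PortU8.portPieceLocalityU8_LocUniv_images` via PTB-1's
images §4): for every admissible `McGuard F Mc`, `Mc ≤ Mg` THERE ARE φ′-uniform `C₉ ≥ 0`, `δ₀ > 0` such that for every dressing-potential family `φ′` with `DressLink … (φ′ k n)` and HypAn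
for `recordEmbJ`, D1 gives [E].  CONDITIONAL; `DressLink`, HypAn, D1 OPEN; K0ᴬ OPEN; the Yang–Mills mass gap is NOT proved.
[cite: Balaban1987RG1, Thm 1 p.259, (1.18)–(1.22) pp.263–264, (4.8) p.283, (4.35)–(4.37) pp.290–291, (5.10) p.293; Balaban1985Variational, Prop. 9 p.309; Balaban1984PropagatorsII, (2.35) p.228] -/
theorem twoVolExp_dressed_images {E₀ κ Mg c₁ : ℝ}
    (hE₀ : 0 ≤ E₀) (hκ : 4 * B12TreeDecay.kappa₀ (4 * 2 ^ 4) (2 * 4) ≤ κ) (hMg : 0 < Mg) (hc₁ : 0 ≤ c₁) :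
    ∀ (F : T4Family) (a₀ ε₂₉ γ₀ α₀ α₁ : ℝ), 0 < a₀ → 0 < ε₂₉ → 0 < α₀ → 0 < α₁ → ∀ Mc : ℕ, McGuard F Mc → (Mc : ℝ) ≤ Mg →
      ∃ C₉ δ₀ : ℝ, 0 ≤ C₉ ∧ 0 < δ₀ ∧
      letI θ := thetaFill F a₀ ε₂₉; letI := θ.instVβ₁; letI := θ.instVβ₂; letI := θ.instιβ
      ∀ (φ' : (k n : ℕ) → RespLabel F k (recordK₀ F Mc k + n) → θ.ιβ → Site (F.P (recordK₀ F Mc k + n)) 0 → Fin 3 → ℂ),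
      (∀ k n : ℕ, DressLink F θ k (recordK₀ F Mc k + n) (φ' k n)) →
      (∀ k n : ℕ, ContDiffAt ℝ 2 (recordEmbJ F θ k (recordK₀ F Mc k + n)) 0) →
      ((∀ (k : ℕ) (g : ℕ → ℝ), FlowStep.RGEqH k (betaOfRecord₁₃Ax F 2 (thetaFill F a₀ ε₂₉)) g → Step.InInterval γ₀ k g →
        B12FormatPlus.FormatPlusG (fun n => recordDomSys F Mc k (recordK₀ F Mc k + n)) (fun n => recordBondCount F (recordK₀ F Mc k + n))
          (fun n => recordAct F (recordK₀ F Mc k + n)) (fun n => recordUc F Mc k α₀ α₁ (recordK₀ F Mc k + n))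
          (fun n => recordCoords F Mc k (recordK₀ F Mc k + n)) (fun n => recordChartDimJ F (recordK₀ F Mc k + n))
          (fun n => recordChartJ F Mc k (recordK₀ F Mc k + n)) (fun n => recordΦfAx F a₀ ε₂₉ k (FlowStep.prefixOf g k) (recordK₀ F Mc k + n))
          (fun n => recordEmbJ F θ k (recordK₀ F Mc k + n)) (fun n => recordWrapCtr F Mc k (recordK₀ F Mc k + n))
          (fun n => recordDomEmbCtr F Mc k (recordK₀ F Mc k + n)) (fun n _ => recordCoordProjCtr F (recordK₀ F Mc k + n)) E₀ κ) →
      RecordPvolTwoVolExpOnRunsAx F a₀ ε₂₉ γ₀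
        (48 * E₀ * C₉ ^ 2 * B12TreeDecay.K₀ (4 * 2 ^ 4) (2 * 4) * (2 * (1 - Real.exp (-(δ₀ / 4)))⁻¹) ^ 4 +
          32 * E₀ * C₉ ^ 2 * Real.exp (B12Decay510.delta1 δ₀ κ Mg * Mg * c₁) * B12TreeDecay.K₀ (4 * 2 ^ 4) (2 * 4) * (2 * (1 - Real.exp (-(δ₀ / 4)))⁻¹) ^ 4)
        (B12Decay510.delta1 δ₀ κ Mg * (1 / 16))) := by
  intro F a₀ ε₂₉ γ₀ α₀ α₁ ha₀ hε hα₀ hα₁ Mc hMc hMgMc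
  letI θ := thetaFill F a₀ ε₂₉; letI := θ.instVβ₁; letI := θ.instVβ₂; letI := θ.instιβ
  obtain ⟨C₉, δ₀, hC₉, hδ₀, h⟩ := twoVolExp_LocUniv_images hE₀ hκ hMg hc₁ F a₀ ε₂₉ γ₀ α₀ α₁ hε hα₀ hα₁ Mc hMc hMgMc
  have hz : ∀ k n : ℕ, (letI θ := thetaFill F a₀ ε₂₉; letI := θ.instVβ₁; letI := θ.instVβ₂;
      recordEmbJ F θ k (recordK₀ F Mc k + n) 0) = 0 := fun k n => PortU8.recordEmbJ_zero_thetaFill F a₀ ε₂₉ ha₀ Mc k n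
  refine ⟨C₉, δ₀, hC₉, hδ₀, fun φ' hDL hAn h8 => h (fun k n => recordEmbJDressed F (thetaFill F a₀ ε₂₉) k (recordK₀ F Mc k + n) (φ' k n)) h8 ?_ ?_⟩
  · intro k n
    exact eventually_recordChartJ_recordEmbJDressed F (thetaFill F a₀ ε₂₉) Mc k (recordK₀ F Mc k + n) (φ' k n) (hAn k n).continuousAt (hz k n)
  · intro k
    refine ⟨fun n => ⟨contDiffAt_recordEmbJDressed F (thetaFill F a₀ ε₂₉) k (recordK₀ F Mc k + n) (φ' k n) (hAn k n) (hz k n),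
      recordEmbJDressed_zero_thetaFill F a₀ ε₂₉ ha₀ Mc k n (φ' k n)⟩, fun n a l => ?_⟩
    exact recordGkLocWξ_univ_eq_fderiv_recordEmbJDressed F (thetaFill F a₀ ε₂₉) k (recordK₀ F Mc k + n) (φ' k n) (hDL k n) a l
      ((hAn k n).differentiableAt (by norm_num)) (hz k n)

/-! ## §2  ★★★ `twoVolExp_orbit_images` — B-4 without (Tok-cmpU-cap) -/

/-- ★★★ **`twoVolExp_orbit_images`** = ▶`twoVolExp_orbit_of_cmp` (B-4 §2) with the hypothesis `TokCmpUCap F Mc a₀ →` DELETED (№549): for every admissible `McGuard F Mc`, `Mc ≤ Mg` THERE ARE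
`C₉ ≥ 0`, `δ₀ > 0` such that (C-orb) `RootedResponseOrbitAt` on the record volumes, C² entries of the rooted background field at `B = 0` (TokP9reg♭) and D1 (⁸'s mould at `recordEmbJ` on
`]0, γ₀]`-runs) give [E] `RecordPvolTwoVolExpOnRunsAx F a₀ ε₂₉ γ₀ E (δ₁∕16)`.  CONDITIONAL; (C-orb), TokP9reg♭, D1 OPEN; K0ᴬ OPEN; the Yang–Mills mass gap is NOT proved.
[cite: Balaban1987RG1, Thm 1 p.259, (1.18)–(1.22) pp.263–264, (4.8) p.283, (4.35)–(4.37) pp.290–291, (5.10) p.293; Balaban1985Variational, Prop. 9 p.309, (176)–(178) p.306; Balaban1984PropagatorsII, (2.12) p.225, (2.35) p.228] -/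
theorem twoVolExp_orbit_images {E₀ κ Mg c₁ : ℝ}
    (hE₀ : 0 ≤ E₀) (hκ : 4 * B12TreeDecay.kappa₀ (4 * 2 ^ 4) (2 * 4) ≤ κ) (hMg : 0 < Mg) (hc₁ : 0 ≤ c₁) :
    ∀ (F : T4Family) (a₀ ε₂₉ γ₀ α₀ α₁ : ℝ), 0 < a₀ → 0 < ε₂₉ → 0 < α₀ → 0 < α₁ → ∀ Mc : ℕ, McGuard F Mc → (Mc : ℝ) ≤ Mg →
      ∃ C₉ δ₀ : ℝ, 0 ≤ C₉ ∧ 0 < δ₀ ∧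
      letI θ := thetaFill F a₀ ε₂₉; letI := θ.instVβ₁; letI := θ.instVβ₂; letI := θ.instιβ
      (∀ (k n : ℕ) (a : θ.ιβ) (l : RespLabel F k (recordK₀ F Mc k + n)), RootedResponseOrbitAt F θ k (recordK₀ F Mc k + n) a l) →
      (∀ k n : ℕ, ContDiffAt ℝ 2 (fun B : recordW F a₀ ε₂₉ k (recordK₀ F Mc k + n) => fun (b : PBond (F.P (recordK₀ F Mc k + n)) 0) (i i' : Fin 2) =>
        ((recordBgField F θ k (recordK₀ F Mc k + n) B b : SU 2) : Matrix (Fin 2) (Fin 2) ℂ) i i') 0) →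
      ((∀ (k : ℕ) (g : ℕ → ℝ), FlowStep.RGEqH k (betaOfRecord₁₃Ax F 2 (thetaFill F a₀ ε₂₉)) g → Step.InInterval γ₀ k g →
        B12FormatPlus.FormatPlusG (fun n => recordDomSys F Mc k (recordK₀ F Mc k + n)) (fun n => recordBondCount F (recordK₀ F Mc k + n))
          (fun n => recordAct F (recordK₀ F Mc k + n)) (fun n => recordUc F Mc k α₀ α₁ (recordK₀ F Mc k + n))
          (fun n => recordCoords F Mc k (recordK₀ F Mc k + n)) (fun n => recordChartDimJ F (recordK₀ F Mc k + n))
          (fun n => recordChartJ F Mc k (recordK₀ F Mc k + n)) (fun n => recordΦfAx F a₀ ε₂₉ k (FlowStep.prefixOf g k) (recordK₀ F Mc k + n))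
          (fun n => recordEmbJ F θ k (recordK₀ F Mc k + n)) (fun n => recordWrapCtr F Mc k (recordK₀ F Mc k + n))
          (fun n => recordDomEmbCtr F Mc k (recordK₀ F Mc k + n)) (fun n _ => recordCoordProjCtr F (recordK₀ F Mc k + n)) E₀ κ) →
      RecordPvolTwoVolExpOnRunsAx F a₀ ε₂₉ γ₀
        (48 * E₀ * C₉ ^ 2 * B12TreeDecay.K₀ (4 * 2 ^ 4) (2 * 4) * (2 * (1 - Real.exp (-(δ₀ / 4)))⁻¹) ^ 4 +
          32 * E₀ * C₉ ^ 2 * Real.exp (B12Decay510.delta1 δ₀ κ Mg * Mg * c₁) * B12TreeDecay.K₀ (4 * 2 ^ 4) (2 * 4) * (2 * (1 - Real.exp (-(δ₀ / 4)))⁻¹) ^ 4)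
        (B12Decay510.delta1 δ₀ κ Mg * (1 / 16))) := by
  intro F a₀ ε₂₉ γ₀ α₀ α₁ ha₀ hε hα₀ hα₁ Mc hMc hMgMc
  letI θ := thetaFill F a₀ ε₂₉; letI := θ.instVβ₁; letI := θ.instVβ₂; letI := θ.instιβ
  obtain ⟨C₉, δ₀, hC₉, hδ₀, h⟩ := twoVolExp_dressed_images hE₀ hκ hMg hc₁ F a₀ ε₂₉ γ₀ α₀ α₁ ha₀ hε hα₀ hα₁ Mc hMc hMgMc
  refine ⟨C₉, δ₀, hC₉, hδ₀, fun horb hd2 h8 => ?_⟩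
  -- the standing range at the record volumes `K := recordK₀ F Mc k + n`
  have hk : ∀ k n : ℕ, k + 1 ≤ (F.P (recordK₀ F Mc k + n)).m + (F.P (recordK₀ F Mc k + n)).K := fun k n => by
    simp only [T4Family.P_m, T4Family.P_K, recordK₀]
    omega
  -- §1: the dressing potentials, volume by volume
  choose φ' hφ' using fun k n => K0AxCtabUniq.dressLink_of_orbit F a₀ ε₂₉ ha₀ k (recordK₀ F Mc k + n) (hk k n) (hd2 k n) (horb k n)
  -- HypAn for `recordEmbJ` from the C² entries
  have hAn : ∀ k n : ℕ, ContDiffAt ℝ 2 (recordEmbJ F θ k (recordK₀ F Mc k + n)) 0 := fun k n =>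
    PortU8.contDiffAt_recordEmbJ_of F θ k (recordK₀ F Mc k + n) (hk k n) ha₀ (PortU8.contDiffAt_matrix_of_entries (hd2 k n))
  exact h φ' hφ' hAn h8

end Summit.QuantumFields.YangMills.Theorems.K0AxJoinT

end
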